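import Summits.CriticalPhenomena.PercolationContinuityZ3.Theorems.PercNearOneGluingNoHeavyLowerTailSahiGridPatternCoCountProductNOrTwo

/-!
# `NoHeavyLowerTail` (crux stmt-CriticalPhenomena-4575), Sahi programme P1: **CONJECTURE A FOR `S = x ∨ y` REDUCED TO NINE UNCROSSING TERMS** —
# at an ARBITRARY pair of up-sets, condition (N) for the co-count product of the recursive certificate of `{x≥1}∨{y≥1}` with any boxed certificate of any
# up-set `V ⊆ [3]^k` holds up to the weighted sum of the uncrossing terms of the nine incomparable outer cell pairs (every `k`)

Support file (Sahi cell, seat `prim-sahi-p1`, generation 40; `--supports stmt-CriticalPhenomena-4575`).  Pure proofs, no definitions, no `sorry`, standard axioms.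
Continuation of `…SahiGridPatternCoCountProductNOrTwo` (same generation: `theta_pair_le_of_nested`, `sect_mono`, `cell_sum_mono`, `ind_orTwo_vals`,
`thetaWeight_orTwo_expand`, the co-monotone theorem), whose vocabulary and setting are used verbatim.

THE MATHEMATICS (seat memo FROM-prim-sahi-p1-gen40 §2).  For `S = {x≥1}∨{y≥1} ⊆ [3]²` with its recursive certificate `c = (0 | 4 | 2 | 5)` and `A = S × V`, the (N)-slack of
the co-count product `e` at a test pair `(P,Q)` decomposes EXACTLY as `R₀ + KP + Σ_{pairs} w(ρ − unc)` (memo §2; box term, Kleitman products, fourteen crossed-route slacks,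
nine uncrossing terms).  Here the three nonnegative groups are dropped and the uncrossing terms are kept:
* `rect_uncross` — for any kernel `f` and finsets: `f(X×Y') + f(X'×Y) = f((X∩X')×(Y∪Y')) + f((X∪X')×(Y∩Y')) + f((X∖X')×(Y'∖Y)) + f((X'∖X)×(Y∖Y'))`;
* `theta_pair_le_uncross` — for up-sets `X, X', Y, Y'` and `d ≥ 0` with (N) for `V`: `Θ_V(X×Y') + Θ_V(X'×Y) ≤ d(X∩Y) + d(X'∩Y') + unc`,
  `unc = Θ_V((X∖X')×(Y'∖Y)) + Θ_V((X'∖X)×(Y∖Y'))` (route U: uncross, (N) at `(X∩X', Y∪Y')` and `(X∪X', Y∩Y')`, modularity of `d`);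
* **`diagCert_coProduct_N_orTwo_le_uncross`** (every `k`, ALL up-sets `P, Q ⊆ [3]^{2+k}`):
  `Θ_{S×V}(P×Q) ≤ e(P∩Q) + Σ_{9 incomparable {σ,σ'}} w(σ,σ')·[Θ_V((P^σ∖P^{σ'})×(Q^{σ'}∖Q^σ)) + Θ_V((P^{σ'}∖P^σ)×(Q^σ∖Q^{σ'}))]`  (`w = 2` on `{12,21}`, else `1`),
  so (N) holds at every pair where this weighted sum is `≤ 0` (the co-monotone theorem of the companion file is the case where every term vanishes).
STATUS of the remainder: the seat's instance-LP (memo §2bis) shows that no test-pair-oblivious routing bounds the nine terms by the dropped groups; the adversarial LP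
hunts (k ≤ 4) found no violation of (N) itself.  Nothing here asserts Conjecture A in general or `PatternPos d` for `d ≥ 4`. [this work]
-/

namespace Summit.CriticalPhenomena.PercolationContinuityZ3.Theorems.SahiGridPattern

open Finset SahiGrid3
open scoped BigOperators

variable {k : ℕ}


section OrTwoUncross

variable {S : Finset (Pd (1 + 1))} {V : Finset (Pd k)} {A : Finset (Pd ((1 + 1) + k))}

/-- **Uncrossing a pair of rectangles** (any kernel `f`, any finsets): `f(X×Y') + f(X'×Y) = f((X∩X')×(Y∪Y')) + f((X∪X')×(Y∩Y')) + f((X∖X')×(Y'∖Y)) + f((X'∖X)×(Y∖Y'))`.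
[this work] -/
theorem rect_uncross {γ : Type*} [Fintype γ] [DecidableEq γ] (f : γ → γ → ℤ) (X X' Y Y' : Finset γ) :
    (∑ q ∈ X, ∑ r ∈ Y', f q r) + (∑ q ∈ X', ∑ r ∈ Y, f q r)
      = (∑ q ∈ X ∩ X', ∑ r ∈ Y ∪ Y', f q r) + (∑ q ∈ X ∪ X', ∑ r ∈ Y ∩ Y', f q r)
        + (∑ q ∈ X \ X', ∑ r ∈ Y' \ Y, f q r) + (∑ q ∈ X' \ X, ∑ r ∈ Y \ Y', f q r) := by
  have e : ∀ (A B : Finset γ), (∑ q ∈ A, ∑ r ∈ B, f q r) = ∑ q, ∑ r, ind A q * ind B r * f q r := by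
    intro A B
    rw [sum_mem_eq_sum_ind_mul]
    refine Finset.sum_congr rfl fun q _ => ?_
    rw [sum_mem_eq_sum_ind_mul, Finset.mul_sum]
    refine Finset.sum_congr rfl fun r _ => ?_
    ring
  have sd : ∀ (A B : Finset γ) (x : γ), ind (A \ B) x = ind A x * (1 - ind B x) := by
    intro A B x
    unfold ind
    by_cases hA : x ∈ A <;> by_cases hB : x ∈ B <;> simp [hA, hB]
  simp only [e, ind_inter_eq_mul, ind_union_eq, sd, ← Finset.sum_add_distrib]
  refine Finset.sum_congr rfl fun q _ => Finset.sum_congr rfl fun r _ => ?_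
  ring

/-- **The pair bound at an ARBITRARY pair of cells**: for up-sets `X, X', Y, Y'` of `[3]^k` and `d ≥ 0` with (N) for `V`,
`Θ_V(X×Y') + Θ_V(X'×Y) ≤ d(X∩Y) + d(X'∩Y') + unc`, `unc = Θ_V((X∖X')×(Y'∖Y)) + Θ_V((X'∖X)×(Y∖Y'))` (route U: uncross, two instances of (N) at
`(X∩X', Y∪Y')`, `(X∪X', Y∩Y')`, then modularity of `d`: the two footprints have union inside `(X∩Y) ∪ (X'∩Y')` and intersection `X∩X'∩Y∩Y'`). [this work] -/
theorem theta_pair_le_uncross {V : Finset (Pd k)} (d : Pd k → ℤ) (hd0 : ∀ q, 0 ≤ d q)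
    (hN : ∀ X X' : Finset (Pd k), IsUpperSet (X : Set (Pd k)) → IsUpperSet (X' : Set (Pd k)) →
      (∑ q ∈ X, ∑ r ∈ X', thetaVal V q r) ≤ ∑ q ∈ X ∩ X', d q)
    {X X' Y Y' : Finset (Pd k)} (hX : IsUpperSet (X : Set (Pd k))) (hX' : IsUpperSet (X' : Set (Pd k)))
    (hY : IsUpperSet (Y : Set (Pd k))) (hY' : IsUpperSet (Y' : Set (Pd k))) :
    (∑ q ∈ X, ∑ r ∈ Y', thetaVal V q r) + (∑ q ∈ X', ∑ r ∈ Y, thetaVal V q r)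
      ≤ (∑ q ∈ X ∩ Y, d q) + (∑ q ∈ X' ∩ Y', d q)
        + ((∑ q ∈ X \ X', ∑ r ∈ Y' \ Y, thetaVal V q r) + ∑ q ∈ X' \ X, ∑ r ∈ Y \ Y', thetaVal V q r) := by
  rw [rect_uncross (thetaVal V) X X' Y Y']
  have hXX : IsUpperSet (((X ∩ X' : Finset (Pd k))) : Set (Pd k)) := isUpperSet_inter_coe hX hX'
  have hYY : IsUpperSet (((Y ∩ Y' : Finset (Pd k))) : Set (Pd k)) := isUpperSet_inter_coe hY hY'
  have hXu : IsUpperSet (((X ∪ X' : Finset (Pd k))) : Set (Pd k)) := by rw [Finset.coe_union]; exact hX.union hX'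
  have hYu : IsUpperSet (((Y ∪ Y' : Finset (Pd k))) : Set (Pd k)) := by rw [Finset.coe_union]; exact hY.union hY'
  have h1 := hN (X ∩ X') (Y ∪ Y') hXX hYu
  have h2 := hN (X ∪ X') (Y ∩ Y') hXu hYY
  have hui : (∑ q ∈ (X ∩ X' ∩ (Y ∪ Y')) ∪ ((X ∪ X') ∩ (Y ∩ Y')), d q) + (∑ q ∈ (X ∩ X' ∩ (Y ∪ Y')) ∩ ((X ∪ X') ∩ (Y ∩ Y')), d q)
      = (∑ q ∈ X ∩ X' ∩ (Y ∪ Y'), d q) + ∑ q ∈ (X ∪ X') ∩ (Y ∩ Y'), d q := Finset.sum_union_inter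
  have hvi : (∑ q ∈ (X ∩ Y) ∪ (X' ∩ Y'), d q) + (∑ q ∈ (X ∩ Y) ∩ (X' ∩ Y'), d q) = (∑ q ∈ X ∩ Y, d q) + ∑ q ∈ X' ∩ Y', d q :=
    Finset.sum_union_inter
  have hsub1 : (X ∩ X' ∩ (Y ∪ Y')) ∪ ((X ∪ X') ∩ (Y ∩ Y')) ⊆ (X ∩ Y) ∪ (X' ∩ Y') := by
    intro q hq
    simp only [Finset.mem_union, Finset.mem_inter] at hq ⊢
    rcases hq with ⟨⟨h1q, h2q⟩, h3q | h3q⟩ | ⟨h1q | h1q, h2q, h3q⟩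
    · exact Or.inl ⟨h1q, h3q⟩
    · exact Or.inr ⟨h2q, h3q⟩
    · exact Or.inl ⟨h1q, h2q⟩
    · exact Or.inr ⟨h1q, h3q⟩
  have hsub2 : (X ∩ X' ∩ (Y ∪ Y')) ∩ ((X ∪ X') ∩ (Y ∩ Y')) ⊆ (X ∩ Y) ∩ (X' ∩ Y') := by
    intro q hq
    simp only [Finset.mem_union, Finset.mem_inter] at hq ⊢
    exact ⟨⟨hq.1.1.1, hq.2.2.1⟩, hq.1.1.2, hq.2.2.2⟩
  have e1 := Finset.sum_le_sum_of_subset_of_nonneg hsub1 (fun q _ _ => hd0 q)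
  have e2 := Finset.sum_le_sum_of_subset_of_nonneg hsub2 (fun q _ _ => hd0 q)
  linarith

/-- **THEOREM (the AND star `(x∨y) × V`: reduction of condition (N) to the nine uncrossing terms; every `k`, ALL test pairs).**  Same data as
`diagCert_coProduct_N_orTwo_of_comonotone` but `P, Q` ARBITRARY up-sets: condition (N) holds up to the weighted sum of the uncrossing terms
`unc(σ,σ') = Θ_V((P^σ∖P^{σ'})×(Q^{σ'}∖Q^σ)) + Θ_V((P^{σ'}∖P^σ)×(Q^σ∖Q^{σ'}))` over the nine incomparable outer cell pairs (weight `2` on `{12,21}`, else `1`).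
So (N) holds wherever this sum is `≤ 0` — the co-monotone case being `unc ≡ 0`.  (What is dropped on the way: the box term `R₀`, the Kleitman products of
`theta_blockAnd_le` and the fourteen crossed-route slacks — memo gen40 §2.) [this work] -/
theorem diagCert_coProduct_N_orTwo_le_uncross (hS : ∀ ξ η : Pd 1, glue ξ η ∈ S ↔ (1 ≤ ξ 0 ∨ 1 ≤ η 0))
    (hSu : IsUpperSet (S : Set (Pd (1 + 1)))) (hV : IsUpperSet (V : Set (Pd k))) (hA : ∀ σ z, glue σ z ∈ A ↔ (σ ∈ S ∧ z ∈ V))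
    (dS : Pd (1 + 1) → ℤ) (hdS : dS (glue (fun _ => 0) (fun _ => 0)) = 0 ∧ dS (glue (fun _ => 0) (fun _ => 1)) = 4 ∧ dS (glue (fun _ => 0) (fun _ => 2)) = 4 ∧
      dS (glue (fun _ => 1) (fun _ => 0)) = 2 ∧ dS (glue (fun _ => 1) (fun _ => 1)) = 5 ∧ dS (glue (fun _ => 1) (fun _ => 2)) = 5 ∧
      dS (glue (fun _ => 2) (fun _ => 0)) = 2 ∧ dS (glue (fun _ => 2) (fun _ => 1)) = 5 ∧ dS (glue (fun _ => 2) (fun _ => 2)) = 5)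
    (dV : Pd k → ℤ) (hdV : ∀ q, 0 ≤ dV q) (hmV : ∀ q : Pd k, dV q ≤ 2 * (2:ℤ) ^ k * ind V q)
    (hNV : ∀ X X' : Finset (Pd k), IsUpperSet (X : Set (Pd k)) → IsUpperSet (X' : Set (Pd k)) → (∑ q ∈ X, ∑ r ∈ X', thetaVal V q r) ≤ ∑ q ∈ X ∩ X', dV q)
    {P Q : Finset (Pd ((1 + 1) + k))} (hP : IsUpperSet (P : Set (Pd ((1 + 1) + k)))) (hQ : IsUpperSet (Q : Set (Pd ((1 + 1) + k)))) :
    (∑ x ∈ P, ∑ y ∈ Q, thetaVal A x y) ≤ (∑ x ∈ P ∩ Q, (2 * (2:ℤ) ^ ((1 + 1) + k) * (ind S (freeOf x) * ind V (cellOf x))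
        - (2 * (2:ℤ) ^ (1 + 1) * ind S (freeOf x) - dS (freeOf x)) * (2 * (2:ℤ) ^ k * ind V (cellOf x) - dV (cellOf x))))
      + (((∑ q ∈ sect P (glue (fun _ => 0) (fun _ => 1)) \ sect P (glue (fun _ => 1) (fun _ => 0)), ∑ r ∈ sect Q (glue (fun _ => 1) (fun _ => 0)) \ sect Q (glue (fun _ => 0) (fun _ => 1)), thetaVal V q r) + ∑ q ∈ sect P (glue (fun _ => 1) (fun _ => 0)) \ sect P (glue (fun _ => 0) (fun _ => 1)), ∑ r ∈ sect Q (glue (fun _ => 0) (fun _ => 1)) \ sect Q (glue (fun _ => 1) (fun _ => 0)), thetaVal V q r)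
      + ((∑ q ∈ sect P (glue (fun _ => 0) (fun _ => 1)) \ sect P (glue (fun _ => 2) (fun _ => 0)), ∑ r ∈ sect Q (glue (fun _ => 2) (fun _ => 0)) \ sect Q (glue (fun _ => 0) (fun _ => 1)), thetaVal V q r) + ∑ q ∈ sect P (glue (fun _ => 2) (fun _ => 0)) \ sect P (glue (fun _ => 0) (fun _ => 1)), ∑ r ∈ sect Q (glue (fun _ => 0) (fun _ => 1)) \ sect Q (glue (fun _ => 2) (fun _ => 0)), thetaVal V q r)
      + ((∑ q ∈ sect P (glue (fun _ => 0) (fun _ => 2)) \ sect P (glue (fun _ => 1) (fun _ => 0)), ∑ r ∈ sect Q (glue (fun _ => 1) (fun _ => 0)) \ sect Q (glue (fun _ => 0) (fun _ => 2)), thetaVal V q r) + ∑ q ∈ sect P (glue (fun _ => 1) (fun _ => 0)) \ sect P (glue (fun _ => 0) (fun _ => 2)), ∑ r ∈ sect Q (glue (fun _ => 0) (fun _ => 2)) \ sect Q (glue (fun _ => 1) (fun _ => 0)), thetaVal V q r)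
      + ((∑ q ∈ sect P (glue (fun _ => 0) (fun _ => 2)) \ sect P (glue (fun _ => 1) (fun _ => 1)), ∑ r ∈ sect Q (glue (fun _ => 1) (fun _ => 1)) \ sect Q (glue (fun _ => 0) (fun _ => 2)), thetaVal V q r) + ∑ q ∈ sect P (glue (fun _ => 1) (fun _ => 1)) \ sect P (glue (fun _ => 0) (fun _ => 2)), ∑ r ∈ sect Q (glue (fun _ => 0) (fun _ => 2)) \ sect Q (glue (fun _ => 1) (fun _ => 1)), thetaVal V q r)
      + ((∑ q ∈ sect P (glue (fun _ => 0) (fun _ => 2)) \ sect P (glue (fun _ => 2) (fun _ => 0)), ∑ r ∈ sect Q (glue (fun _ => 2) (fun _ => 0)) \ sect Q (glue (fun _ => 0) (fun _ => 2)), thetaVal V q r) + ∑ q ∈ sect P (glue (fun _ => 2) (fun _ => 0)) \ sect P (glue (fun _ => 0) (fun _ => 2)), ∑ r ∈ sect Q (glue (fun _ => 0) (fun _ => 2)) \ sect Q (glue (fun _ => 2) (fun _ => 0)), thetaVal V q r)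
      + ((∑ q ∈ sect P (glue (fun _ => 0) (fun _ => 2)) \ sect P (glue (fun _ => 2) (fun _ => 1)), ∑ r ∈ sect Q (glue (fun _ => 2) (fun _ => 1)) \ sect Q (glue (fun _ => 0) (fun _ => 2)), thetaVal V q r) + ∑ q ∈ sect P (glue (fun _ => 2) (fun _ => 1)) \ sect P (glue (fun _ => 0) (fun _ => 2)), ∑ r ∈ sect Q (glue (fun _ => 0) (fun _ => 2)) \ sect Q (glue (fun _ => 2) (fun _ => 1)), thetaVal V q r)
      + ((∑ q ∈ sect P (glue (fun _ => 1) (fun _ => 1)) \ sect P (glue (fun _ => 2) (fun _ => 0)), ∑ r ∈ sect Q (glue (fun _ => 2) (fun _ => 0)) \ sect Q (glue (fun _ => 1) (fun _ => 1)), thetaVal V q r) + ∑ q ∈ sect P (glue (fun _ => 2) (fun _ => 0)) \ sect P (glue (fun _ => 1) (fun _ => 1)), ∑ r ∈ sect Q (glue (fun _ => 1) (fun _ => 1)) \ sect Q (glue (fun _ => 2) (fun _ => 0)), thetaVal V q r)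
      + ((∑ q ∈ sect P (glue (fun _ => 1) (fun _ => 2)) \ sect P (glue (fun _ => 2) (fun _ => 0)), ∑ r ∈ sect Q (glue (fun _ => 2) (fun _ => 0)) \ sect Q (glue (fun _ => 1) (fun _ => 2)), thetaVal V q r) + ∑ q ∈ sect P (glue (fun _ => 2) (fun _ => 0)) \ sect P (glue (fun _ => 1) (fun _ => 2)), ∑ r ∈ sect Q (glue (fun _ => 1) (fun _ => 2)) \ sect Q (glue (fun _ => 2) (fun _ => 0)), thetaVal V q r)
      + 2 * ((∑ q ∈ sect P (glue (fun _ => 1) (fun _ => 2)) \ sect P (glue (fun _ => 2) (fun _ => 1)), ∑ r ∈ sect Q (glue (fun _ => 2) (fun _ => 1)) \ sect Q (glue (fun _ => 1) (fun _ => 2)), thetaVal V q r) + ∑ q ∈ sect P (glue (fun _ => 2) (fun _ => 1)) \ sect P (glue (fun _ => 1) (fun _ => 2)), ∑ r ∈ sect Q (glue (fun _ => 1) (fun _ => 2)) \ sect Q (glue (fun _ => 2) (fun _ => 1)), thetaVal V q r)) := by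
  obtain ⟨s00, s01, s02, s10, s11, s12, s20, s21, s22⟩ := hdS
  obtain ⟨u00, u01, u02, u10, u11, u12, u20, u21, u22⟩ := ind_orTwo_vals hS
  have f01 : ((fun _ => (0:Fin 3)) : Pd 1) ≤ (fun _ => 1) := fun _ => (by decide : (0:Fin 3) ≤ 1)
  have f02 : ((fun _ => (0:Fin 3)) : Pd 1) ≤ (fun _ => 2) := fun _ => (by decide : (0:Fin 3) ≤ 2)
  have f12 : ((fun _ => (1:Fin 3)) : Pd 1) ≤ (fun _ => 2) := fun _ => (by decide : (1:Fin 3) ≤ 2)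
  have f11 : ((fun _ => (1:Fin 3)) : Pd 1) ≤ (fun _ => 1) := le_rfl
  have f22 : ((fun _ => (2:Fin 3)) : Pd 1) ≤ (fun _ => 2) := le_rfl
  have cle : ∀ {a b a' b' : Pd 1}, a ≤ a' → b ≤ b' → (glue a b : Pd (1 + 1)) ≤ glue a' b' := fun ha hb => glue_le_glue_iff.2 ⟨ha, hb⟩
  have hdom := theta_blockAnd_le hA hSu hV hP hQ
  rw [thetaWeight_orTwo_expand hS] at hdom
  have hsP : ∀ σ : Pd (1 + 1), IsUpperSet ((sect P σ : Finset (Pd k)) : Set (Pd k)) := fun σ => isUpperSet_sect hP σ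
  have hsQ : ∀ σ : Pd (1 + 1), IsUpperSet ((sect Q σ : Finset (Pd k)) : Set (Pd k)) := fun σ => isUpperSet_sect hQ σ
  have hD : ∀ σ : Pd (1 + 1), (∑ q ∈ sect P σ ∩ sect Q σ, dV q) = ∑ q : Pd k, ind P (glue σ q) * ind Q (glue σ q) * dV q :=
    fun σ => sum_mem_sect_inter_eq dV P Q σ σ
  -- comparable pairs: crossed route without uncrossing term
  have pb : ∀ σ σ' : Pd (1 + 1), σ ≤ σ' →
      (∑ q ∈ sect P σ, ∑ r ∈ sect Q σ', thetaVal V q r) + (∑ q ∈ sect P σ', ∑ r ∈ sect Q σ, thetaVal V q r)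
        ≤ (∑ q : Pd k, ind P (glue σ q) * ind Q (glue σ q) * dV q) + ∑ q : Pd k, ind P (glue σ' q) * ind Q (glue σ' q) * dV q := by
    intro σ σ' h
    rw [← hD σ, ← hD σ']
    exact theta_pair_le_of_nested dV hdV hNV (hsP σ) (hsP σ') (hsQ σ) (hsQ σ') (sect_mono hP h) (sect_mono hQ h)
  -- incomparable pairs: crossed route WITH the uncrossing term
  have pu : ∀ σ σ' : Pd (1 + 1),
      (∑ q ∈ sect P σ, ∑ r ∈ sect Q σ', thetaVal V q r) + (∑ q ∈ sect P σ', ∑ r ∈ sect Q σ, thetaVal V q r)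
        ≤ (∑ q : Pd k, ind P (glue σ q) * ind Q (glue σ q) * dV q) + (∑ q : Pd k, ind P (glue σ' q) * ind Q (glue σ' q) * dV q)
          + ((∑ q ∈ sect P σ \ sect P σ', ∑ r ∈ sect Q σ' \ sect Q σ, thetaVal V q r) + ∑ q ∈ sect P σ' \ sect P σ, ∑ r ∈ sect Q σ \ sect Q σ', thetaVal V q r) := by
    intro σ σ'
    rw [← hD σ, ← hD σ']
    exact theta_pair_le_uncross dV hdV hNV (hsP σ) (hsP σ') (hsQ σ) (hsQ σ')
  have p0110 := pu (glue (fun _ => 0) (fun _ => 1)) (glue (fun _ => 1) (fun _ => 0))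
  have p0112 := pb (glue (fun _ => 0) (fun _ => 1)) (glue (fun _ => 1) (fun _ => 2)) (cle f01 f12)
  have p0120 := pu (glue (fun _ => 0) (fun _ => 1)) (glue (fun _ => 2) (fun _ => 0))
  have p0122 := pb (glue (fun _ => 0) (fun _ => 1)) (glue (fun _ => 2) (fun _ => 2)) (cle f02 f12)
  have p0210 := pu (glue (fun _ => 0) (fun _ => 2)) (glue (fun _ => 1) (fun _ => 0))
  have p0211 := pu (glue (fun _ => 0) (fun _ => 2)) (glue (fun _ => 1) (fun _ => 1))
  have p0220 := pu (glue (fun _ => 0) (fun _ => 2)) (glue (fun _ => 2) (fun _ => 0))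
  have p0221 := pu (glue (fun _ => 0) (fun _ => 2)) (glue (fun _ => 2) (fun _ => 1))
  have p1021 := pb (glue (fun _ => 1) (fun _ => 0)) (glue (fun _ => 2) (fun _ => 1)) (cle f12 f01)
  have p1022 := pb (glue (fun _ => 1) (fun _ => 0)) (glue (fun _ => 2) (fun _ => 2)) (cle f12 f02)
  have p1120 := pu (glue (fun _ => 1) (fun _ => 1)) (glue (fun _ => 2) (fun _ => 0))
  have p1122 := pb (glue (fun _ => 1) (fun _ => 1)) (glue (fun _ => 2) (fun _ => 2)) (cle f12 f12)
  have p1220 := pu (glue (fun _ => 1) (fun _ => 2)) (glue (fun _ => 2) (fun _ => 0))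
  have p1221 := pu (glue (fun _ => 1) (fun _ => 2)) (glue (fun _ => 2) (fun _ => 1))
  -- Step 3: the budget `e(P∩Q)` by cells
  have hbud : (∑ x ∈ P ∩ Q, (2 * (2:ℤ) ^ ((1 + 1) + k) * (ind S (freeOf x) * ind V (cellOf x))
      - (2 * (2:ℤ) ^ (1 + 1) * ind S (freeOf x) - dS (freeOf x)) * (2 * (2:ℤ) ^ k * ind V (cellOf x) - dV (cellOf x))))
      = ∑ σ : Pd (1 + 1), ∑ q : Pd k, ind P (glue σ q) * ind Q (glue σ q) *
          (2 * (2:ℤ) ^ ((1 + 1) + k) * (ind S σ * ind V q) - (2 * (2:ℤ) ^ (1 + 1) * ind S σ - dS σ) * (2 * (2:ℤ) ^ k * ind V q - dV q)) := by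
    rw [sum_mem_eq_sum_glue]
    refine Finset.sum_congr rfl fun σ _ => Finset.sum_congr rfl fun q _ => ?_
    rw [ind_inter_eq_mul, freeOf_glue, cellOf_glue]
  -- per-cell budget as `α·(2^k·M(σ)) + m·D(σ)` with `M(σ) = Σ_q 1_P 1_Q 1_V`, `D(σ) = Σ_q 1_P 1_Q d_V`
  have hcell : ∀ (σ : Pd (1 + 1)) (s t : ℤ), ind S σ = s → dS σ = t →
      (∑ q : Pd k, ind P (glue σ q) * ind Q (glue σ q) *
          (2 * (2:ℤ) ^ ((1 + 1) + k) * (ind S σ * ind V q) - (2 * (2:ℤ) ^ (1 + 1) * ind S σ - dS σ) * (2 * (2:ℤ) ^ k * ind V q - dV q)))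
        = (2 * t - 8 * s) * ((2:ℤ) ^ k * ∑ q : Pd k, ind P (glue σ q) * ind Q (glue σ q) * ind V q)
          + (8 * s - t) * (∑ q : Pd k, ind P (glue σ q) * ind Q (glue σ q) * dV q) := by
    intro σ s t hs ht
    rw [Finset.mul_sum, Finset.mul_sum, Finset.mul_sum, ← Finset.sum_add_distrib]
    refine Finset.sum_congr rfl fun q _ => ?_
    rw [hs, ht, pow_add, pow_add, pow_one]
    ring
  -- the remaining budget: `m_V`-weighted cells grow along the outer order (box ⟹ m_V ≥ 0)
  have hm0 : ∀ q : Pd k, 0 ≤ 2 * (2:ℤ) ^ k * ind V q - dV q := fun q => by linarith [hmV q]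
  have gsplit : ∀ σ : Pd (1 + 1), (∑ q : Pd k, ind P (glue σ q) * ind Q (glue σ q) * (2 * (2:ℤ) ^ k * ind V q - dV q))
      = 2 * ((2:ℤ) ^ k * ∑ q : Pd k, ind P (glue σ q) * ind Q (glue σ q) * ind V q) - ∑ q : Pd k, ind P (glue σ q) * ind Q (glue σ q) * dV q := by
    intro σ
    rw [Finset.mul_sum, Finset.mul_sum, ← Finset.sum_sub_distrib]
    refine Finset.sum_congr rfl fun q _ => ?_
    ring
  have gm : ∀ σ σ' : Pd (1 + 1), σ ≤ σ' →
      2 * ((2:ℤ) ^ k * ∑ q : Pd k, ind P (glue σ q) * ind Q (glue σ q) * ind V q) - (∑ q : Pd k, ind P (glue σ q) * ind Q (glue σ q) * dV q)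
        ≤ 2 * ((2:ℤ) ^ k * ∑ q : Pd k, ind P (glue σ' q) * ind Q (glue σ' q) * ind V q) - ∑ q : Pd k, ind P (glue σ' q) * ind Q (glue σ' q) * dV q := by
    intro σ σ' h
    have h1 := cell_sum_mono hP hQ _ hm0 h
    have e1 := gsplit σ
    have e2 := gsplit σ'
    linarith
  have g1011 := gm (glue (fun _ => 1) (fun _ => 0)) (glue (fun _ => 1) (fun _ => 1)) (cle f11 f01)
  have g1012 := gm (glue (fun _ => 1) (fun _ => 0)) (glue (fun _ => 1) (fun _ => 2)) (cle f11 f02)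
  have g2021 := gm (glue (fun _ => 2) (fun _ => 0)) (glue (fun _ => 2) (fun _ => 1)) (cle f22 f01)
  have g2022 := gm (glue (fun _ => 2) (fun _ => 0)) (glue (fun _ => 2) (fun _ => 2)) (cle f22 f02)
  -- the nine cell budgets
  have b00 := hcell (glue (fun _ => 0) (fun _ => 0)) 0 0 u00 s00
  have b01 := hcell (glue (fun _ => 0) (fun _ => 1)) 1 4 u01 s01
  have b02 := hcell (glue (fun _ => 0) (fun _ => 2)) 1 4 u02 s02
  have b10 := hcell (glue (fun _ => 1) (fun _ => 0)) 1 2 u10 s10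
  have b11 := hcell (glue (fun _ => 1) (fun _ => 1)) 1 5 u11 s11
  have b12 := hcell (glue (fun _ => 1) (fun _ => 2)) 1 5 u12 s12
  have b20 := hcell (glue (fun _ => 2) (fun _ => 0)) 1 2 u20 s20
  have b21 := hcell (glue (fun _ => 2) (fun _ => 1)) 1 5 u21 s21
  have b22 := hcell (glue (fun _ => 2) (fun _ => 2)) 1 5 u22 s22
  -- nonnegativity of the corner `M`-sum (its coefficient is `0`; harmless) and of all cell `M`-sums
  have hM0 : ∀ σ : Pd (1 + 1), 0 ≤ (2:ℤ) ^ k * ∑ q : Pd k, ind P (glue σ q) * ind Q (glue σ q) * ind V q :=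
    fun σ => mul_nonneg (pow_nonneg (by norm_num) k) (Finset.sum_nonneg fun q _ =>
      mul_nonneg (mul_nonneg (ind_nonneg' P _) (ind_nonneg' Q _)) (ind_nonneg' V q))
  rw [hbud, sum_glue (n := 1) (k := 1), sum_pd1, sum_pd1, sum_pd1, sum_pd1, b00, b01, b02, b10, b11, b12, b20, b21, b22]
  linarith [hdom, p0110, p0112, p0120, p0122, p0210, p0211, p0220, p0221, p1021, p1022, p1120, p1122, p1220, p1221,
    g1011, g1012, g2021, g2022, hM0 (glue (fun _ => 0) (fun _ => 0))]

end OrTwoUncross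

end Summit.CriticalPhenomena.PercolationContinuityZ3.Theorems.SahiGridPattern
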